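import Summits.BirchSwinnertonDyer.BirchSwinnertonDyer.Theorems.CycTangentCMCycTangentBoundFrameNormRigidity
import Literature.NumberTheory.EllipticCurves.IntSeriesNodeTransport
import HarnessLib

/-!
# Crux `CycTangentCM.CycTangentBound` (stmt-BirchSwinnertonDyer-22628): FRAME TRANSPORT on a power line —
# two typed frames of the same datum with different periods `(Ω, δ, Ω_p)`, `(Ω', δ', Ω_p')`, read on a
# `ℤ_p`-line through nodes `uᵗ − 1`, differ by a UNIT BINOMIAL TWIST `F' = c₀·(1+T)^z·F`, `z ∈ ℤ_p`
# (`--supports 22628`; nothing is closed; BSD is not proved by any of this)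

Seat `prover-bsd-line-ctcm-p2` g3 (D-0145 line `route-BirchSwinnertonDyer-CycTangentCM`, prover 2/3). This
is the exact form of the "period transport" that the negative road (`H` of
`CycTangentBound/Negative/CycTangentBoundFalseOfSplitPrimeLineCertificate`, quantified over ALL frames) and
the registered stub `stub_selfDual` of line `tangent-cone-parity` (quantified over ALL `Ω_p ≠ 0`) kept
running into; seat -p3 g2 proved the NORM form (`CycTangentCMFrameNormRigidity.norm_frameValues_eq`:
`‖x'_t‖ = ‖x_t‖`, from `‖c‖ = 1`), seat -p4 g0 the principal-unit form (`‖c^b − 1‖ < 1`) and named the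
sharpening «`c^b ∈ u^{ℤ_p}`, `(1+T)^e bounded ⟹ e ∈ ℤ_p`» as open. The sharpening is now a chain of
Literature theorems (this seat, `Literature/NumberTheory/LocalFields/`: `BinomialCoefficientsPadicIntegral`
= converse of Gouvêa 5.9.1, `BinomialSeriesDifferentialEquation`, `BinomialTwistExponentPadicIntegral`,
`BinomialTwistOfNodeValues` = Robert V.2.4 Thm 1 along `t ↦ t + p^k` + Strassmann,
`NodeValuesUnitBinomialTwist`; bridge `EllipticCurves/IntSeriesNodeTransport`), and this file states it in
the frame currency of -p3's file:

* `frameValues_unit_binomPow` — under the hypotheses of `norm_frameValues_eq` (two integral series `F, F'`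
  taking at the nodes `uᵗ − 1`, `u ≠ 1`, `‖u − 1‖ < ‖p‖`, the frame values of `(Ω, δ, Ω_p)` resp.
  `(Ω', δ', Ω_p')` along a power line of exponents `a + bt`, one interpolation value `≠ 0`; `b > 0` is
  not even needed) and
  if `F` and `F'` each have a unit coefficient: `F' = C c₀ · binomPow z · F` for a unit `c₀ ∈ 𝒪_{ℂ_p}ˣ`
  and `z ∈ ℤ_p`. Consequently (`IntSeries.hasValueAt_of_unit_binomPow`) `F'(y) = c₀·(1+y)^z·F(y)` at
  EVERY point of the open disc (not only at the nodes), and every statement about `F` read through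
  units of `𝒪_{ℂ_p}⟦T⟧` (unit coefficient in degree `n`, `λ̄`, `μ`, Weierstrass degree) holds for `F'`.

Theorems only (no definition, no fact, no `sorry`); nothing asserts that frames exist; crux 22628 (refuted
numerically by the lead, ¬CTB booked modulo `H`) is not closed here; BSD is not proved by any of this.
References: [deShalit1987] II.4.12 Remark (iv), II.4.16 (50); [Gouvea1993PadicNumbers] §5.9;
[Robert2000PadicAnalysis] V.2.4, VI.2.1.
-/

set_option linter.dupNamespace false
set_option autoImplicit false

noncomputable section

open scoped NumberField
open NumberField IsDedekindDomain PowerSeries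
open Literature.NumberTheory.GaloisRepresentations Literature.NumberTheory.EllipticCurves
open Summit.BirchSwinnertonDyer.BirchSwinnertonDyer.Theorems.CycTangentCMFrameNormRigidity

namespace Summit.BirchSwinnertonDyer.BirchSwinnertonDyer.Theorems.CycTangentCMFrameTransport

variable {p : ℕ} [Fact p.Prime] {K : Type} [Field K] [NumberField K]

/-- **FRAME TRANSPORT ON A POWER LINE.** Let `F, F' ∈ 𝒪_{ℂ_p}⟦T⟧` (e.g. the monomial lines of two typed
frames `G, G'` of the same datum with period triples `(Ω, δ, Ω_p)`, `(Ω', δ', Ω_p')`) take at the nodes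
`uᵗ − 1` (`u ≠ 1`, `‖u − 1‖ < ‖p‖`) the frame values
`ι⁻¹(interpolationValue p v v̄ S ε_t (a + bt) 0 Ω δ L_t)·Ω_p^{a+bt}` resp. the same with `(Ω', δ', Ω_p')`,
for all `t ∈ ℕ` (`Ω, Ω', Ω_p, Ω_p' ≠ 0`; any `a, b`), with ONE interpolation value `≠ 0`, and suppose `F`
and `F'` each have a unit coefficient. Then `F' = C c₀ · binomPow z · F` with `c₀ ∈ 𝒪_{ℂ_p}ˣ`,
`z ∈ ℤ_p`: the two branches differ by a unit binomial twist. -/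
theorem frameValues_unit_binomPow (ι : PadicAlgCl p ≃+* ℂ) (v vbar : HeightOneSpectrum (𝓞 K))
    (S : Finset (HeightOneSpectrum (𝓞 K))) (ε : ℕ → HeckeCharacter K) (L : ℕ → ℂ) {a b : ℕ}
    {Ω Ω' δ δ' : ℂ} {Ωp Ωp' : ℂ_[p]} (hΩ : Ω ≠ 0) (hΩ' : Ω' ≠ 0) (hΩp : Ωp ≠ 0)
    (hΩp' : Ωp' ≠ 0) {F F' : PowerSeries (PadicComplexInt p)} {u : ℂ_[p]} (hu1 : u ≠ 1)
    (hup : ‖u - 1‖ < ‖(p : ℂ_[p])‖)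
    (hx : ∀ t : ℕ, IntSeries.HasValueAt F (u ^ t - 1)
      (((ι.symm (DeShalit1987.interpolationValue p v vbar S (ε t) (a + b * t) 0 Ω δ (L t)) :
          PadicAlgCl p) : ℂ_[p]) * Ωp ^ (a + b * t)))
    (hx' : ∀ t : ℕ, IntSeries.HasValueAt F' (u ^ t - 1)
      (((ι.symm (DeShalit1987.interpolationValue p v vbar S (ε t) (a + b * t) 0 Ω' δ' (L t)) :
          PadicAlgCl p) : ℂ_[p]) * Ωp' ^ (a + b * t)))
    {t₀ : ℕ} (h0 : DeShalit1987.interpolationValue p v vbar S (ε t₀) (a + b * t₀) 0 Ω δ (L t₀) ≠ 0)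
    (hFu : ∃ n, IsUnit (coeff n F)) (hF'u : ∃ n, IsUnit (coeff n F')) :
    ∃ (z : ℤ_[p]) (c₀ : (PadicComplexInt p)ˣ), F' = C ((c₀ : PadicComplexInt p)) * IntSeries.binomPow z * F := by
  -- norms and the node hypothesis
  have hp1 : ‖(p : ℂ_[p])‖ ≤ 1 := by
    rw [← PadicComplex.coe_natCast p p, PadicComplex.norm_extends p]
    exact PadicAlgCl.norm_natCast_self_lt_one.le
  have hu : ‖u - 1‖ < 1 := hup.trans_le hp1
  have hroot : ∀ n : ℕ, 0 < n → u ^ n ≠ 1 := IntSeries.forall_pow_ne_one_of_norm_sub_one_lt hu1 hup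
  -- the constant of proportionality
  set c : ℂ_[p] := ((ι.symm (Ω / Ω') : PadicAlgCl p) : ℂ_[p]) * Ωp' * Ωp⁻¹ with hc_def
  have hc : c ≠ 0 := by
    have h1 : ((ι.symm (Ω / Ω') : PadicAlgCl p) : ℂ_[p]) ≠ 0 := by
      rw [PadicComplex.coe_eq]
      exact (map_ne_zero _).mpr ((map_ne_zero ι.symm).mpr (div_ne_zero hΩ hΩ'))
    exact mul_ne_zero (mul_ne_zero h1 hΩp') (inv_ne_zero hΩp)
  -- the two value families, proportional by `c^a · (c^b)ᵗ`
  set x : ℕ → ℂ_[p] := fun t ↦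
    ((ι.symm (DeShalit1987.interpolationValue p v vbar S (ε t) (a + b * t) 0 Ω δ (L t)) :
        PadicAlgCl p) : ℂ_[p]) * Ωp ^ (a + b * t) with hx_def
  set x' : ℕ → ℂ_[p] := fun t ↦
    ((ι.symm (DeShalit1987.interpolationValue p v vbar S (ε t) (a + b * t) 0 Ω' δ' (L t)) :
        PadicAlgCl p) : ℂ_[p]) * Ωp' ^ (a + b * t) with hx'_def
  have hrel : ∀ s : ℕ, x' s = c ^ a * (c ^ b) ^ s * x s := fun s ↦ by
    rw [← pow_mul, ← pow_add]
    exact frameValue_eq_pow_mul ι v vbar S (ε s) (a + b * s) Ω' δ δ' (L s) Ωp' hΩ hΩp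
  have hx0 : x t₀ ≠ 0 := by
    refine mul_ne_zero ?_ (pow_ne_zero _ hΩp)
    rw [PadicComplex.coe_eq]
    exact (map_ne_zero _).mpr ((map_ne_zero ι.symm).mpr h0)
  exact IntSeries.exists_unit_binomPow_of_values_proportional hu hroot (pow_ne_zero _ hc)
    (pow_ne_zero _ hc) hx hx' hrel hx0 hFu hF'u

/-- **Values transport everywhere, not only at the nodes**: under the same hypotheses, with the unit
twist `F' = C c₀ · binomPow z · F` of `frameValues_unit_binomPow`, `F'(y) = c₀·(1+y)^z·F(y)` at EVERY
point `y` of the open unit disc (`IntSeries.hasValueAt_of_unit_binomPow`, restated for the consumer). -/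
theorem hasValueAt_transport {F F' : PowerSeries (PadicComplexInt p)} {z : ℤ_[p]}
    {c₀ : (PadicComplexInt p)ˣ} (h : F' = C ((c₀ : PadicComplexInt p)) * IntSeries.binomPow z * F)
    {y w : ℂ_[p]} (hy : ‖y‖ < 1) (hw : IntSeries.HasValueAt F y w) :
    IntSeries.HasValueAt F' y (((c₀ : PadicComplexInt p) : ℂ_[p]) * IntSeries.onePlusPow z y * w) :=
  IntSeries.hasValueAt_of_unit_binomPow h hy hw

end Summit.BirchSwinnertonDyer.BirchSwinnertonDyer.Theorems.CycTangentCMFrameTransport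

end
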